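import Summits.ABC.IUTFork.Joshi.ATS4Eq6811Genuine
import Summits.ABC.IUTFork.Joshi.ATS4RamificationDivisorsPrimes
import HarnessLib

/-!
# [J-IV] (arXiv:2403.10430v2) (6.8.11) under E-t31's OWN §6.7 glue: the free-slot hypotheses of `ATS4Eq6811Genuine`
# (p453374) DISCHARGED for every carrier glued by `PrimeTowerDatum.TowerGlue` — R-J row Y-21f, INFO-1 of the double-read

Proof-only reader-companion (0 defs) of the abc-iut cell, R-J «JOSHI Y-DISCHARGE CENSUS» (D-0079; rung LADDER-ABC:A2.RESCUE.J),
row Y-21f, seat abc-iut-E-t24 (gen 8; the counted double-reader of p453374, memo `HOME/plan/E/t24/audit-g8/AUDIT-p453374.md`);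
parents BUILT, every input BY NAME: E-t31 `Joshi/ATS4Eq6811Genuine.lean` (p453374: `LocusVolumeDatum.eq6811_of_genuineTower`),
E-t31 `Joshi/ATS4RamificationDivisorsPrimes.lean` (`PrimeTowerDatum.TowerGlue`, `prime_of_mem_vdstQ`), E-t31
`Joshi/ATS4RamificationDivisors.lean` (p430536: `PrimeTowerDatum`, `VdstQ`, `vdstQ_eq`, `logSQ`, (6.7.2)–(6.7.4) / (6.8.12)). SOURCE:
K. Joshi, *Construction of Arithmetic Teichmüller Spaces IV*, arXiv:2403.10430v2 (unrefereed; bib `Joshi2024ATS4`): (6.8.11)–(6.8.12)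
p.64 l.2–13, §6.6 p.60 l.56–62 «v ∈ V^dst_M, if and only if, v extends to a prime of L′ which is ramified over ℚ», §6.7 p.61 l.14–19
(render `HOME/lit/renders/Joshi-arxiv-2403.10430/`).

FRAMING (binding): NO side is taken on [IUTchIII] Cor. 3.12 / [IUTchIV] Thm. 1.10, on Joshi's claims, or on Mochizuki's report on
them; NO abc claim; typed ≠ proved ≠ endorsed. Nothing is restated; no `def`, no new `Prop`, no instance, no notation.

WHAT IS HERE (all PROVED). p453374 decides (6.8.11) for a carrier `d` whose two free `s`-slots are READ by hypotheses:
`hsQ : d.logsQ = Σ_{q ∈ d.Vdst} log q` ((6.8.12)), `hprime : every q ∈ d.Vdst is prime`, `hdst : every q ∈ d.Vdst divides 2·3·5·ℓ or lies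
under a prime of L′ ramified over ℚ`. When `d` is glued to E-t31's §6.7 tower of primes `T : PrimeTowerDatum` by `TowerGlue T d`
(`d.Vdst = V^dst_ℚ(T)`, `d.logsQ = log(s_ℚ)(T)`, …):
1. `TowerGlue.logsQ_eq_sum_log` — `hsQ` holds BY DEFINITION of `logSQ` ((6.7.2)–(6.7.4) for `L* = ℚ` = (6.8.12)).
2. `TowerGlue.vdst_prime` — `hprime` holds as soon as `T`'s residue characteristics are prime (every faithful instantiation, p.65
   l.31; E-t31 `prime_of_mem_vdstQ`).
3. `TowerGlue.exists_ramified_of_mem_vdst` — every `q ∈ d.Vdst` IS the residue characteristic of a prime of the (abstract) `L′`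
   ramified over `ℚ` (§6.6 read at `ℚ`: E-t31 `vdstQ_eq : V^dst_ℚ = charW '' Ramified`).
4. **`TowerGlue.eq6811_of_genuineTower`** — hence, for a tower `T` whose ramified primes are WITNESSED in a genuine number field `L′`
   («for each `w ∈ T.Ramified` a prime `u` of `L′` with the same residue characteristic and `e(u|p) ≥ 2`» — what a genuine
   instantiation `W := primes of L′`, `Ramified := {u : e(u|p) ≥ 2}`, `charW := residueChar` gives with `u := w`), p453374's
   `LocusVolumeDatum.eq6811_of_genuineTower` applies with `hsQ`, `hprime`, `hdst` ALL discharged: (6.8.11) holds given only the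
   genuine readings of `d_mod`, `log d_{L_tpd}`, `log f_{L_tpd}` and the (D0) descent — the typer row left is «`PrimeTowerDatum` at a
   genuine `L′`» (E-t31 lineage, slot T-31), not a hypothesis on `d`.
RUNG CURRENCY: Y-21f stays DECIDED-DERIVED (p453374); this file removes the «for every §6.6/(6.8.12) instantiation» proviso for
TowerGlue'd carriers. FACT rows: 0. [claim: Joshi2024ATS4, status: disputed] for the locators; the mathematics is bookkeeping +
p453374.
-/

noncomputable section

namespace Summit.ABC.IUTFork.Joshi.ATS4

open NumberField IsDedekindDomain Finset
open Literature.IUT.LogVolume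

namespace PrimeTowerDatum

namespace TowerGlue

variable {T : PrimeTowerDatum} {d : LocusVolumeDatum} (G : TowerGlue T d)
include G

/-- **(6.8.12) holds BY DEFINITION under `TowerGlue`**: `log(s_ℚ) = Σ_{p ∈ V^dst_ℚ} log p` — E-t31's `logSQ` IS that sum ((6.7.2)–(6.7.4)
for `L* = ℚ`, p.61 l.31 – p.62 l.1; (6.8.12) p.64 l.4–13). PROVED (`rfl` after the glue). [claim: Joshi2024ATS4, status: disputed] -/
theorem logsQ_eq_sum_log : d.logsQ = ∑ q ∈ d.Vdst, Real.log q := by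
  rw [G.logsQ_eq, G.vdst_eq]
  rfl

/-- With prime residue characteristics, every element of the glued `V^dst_ℚ` is prime (E-t31 `prime_of_mem_vdstQ`). PROVED. [folklore] -/
theorem vdst_prime (hc : ∀ v : T.Pmod, (T.char v).Prime) {q : ℕ} (hq : q ∈ d.Vdst) : q.Prime := by
  rw [G.vdst_eq, T.mem_vdstQFinset] at hq
  exact T.prime_of_mem_vdstQ hc hq

/-- **§6.6 read at `ℚ` under the glue**: every `q ∈ d.Vdst = V^dst_ℚ` is the residue characteristic of a prime of `L′` ramified over `ℚ`
(E-t31 `vdstQ_eq : V^dst_ℚ = vdst charW = charW '' Ramified`). PROVED. [claim: Joshi2024ATS4, status: disputed] -/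
theorem exists_ramified_of_mem_vdst {q : ℕ} (hq : q ∈ d.Vdst) : ∃ w ∈ T.Ramified, T.charW w = q := by
  rw [G.vdst_eq, T.mem_vdstQFinset, T.vdstQ_eq] at hq
  exact hq

/-- **(6.8.11) for a `TowerGlue`d carrier at a genuine tower — p453374 with its three `s`-slot hypotheses DISCHARGED.** Data as in
E-t31's `LocusVolumeDatum.eq6811_of_genuineTower` (`L_mod ⊆ L_tpd` Galois, `L_tpd ⊆ L′`; `S₀` the full preimage of `S`; `d_mod`,
`log d_{L_tpd}`, `log f_{L_tpd}` read genuinely; the (D0) descent `hD0`), plus: `T`'s residue characteristics are prime, `T.l = d.l`'s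
`ℓ` is the one in `hD0` (automatic: `G.l_eq`), and each ramified prime `w` of `T` is WITNESSED by a prime `u` of the number field `L′`
with `residueChar L′ u = charW w` and `e(u|p) ≥ 2`. THEN `d.Eq6811`. PROVED (composition, BY NAME). [claim: Joshi2024ATS4, status: disputed] -/
theorem eq6811_of_genuineTower
    (Lmod Ltpd L' : Type*) [Field Lmod] [NumberField Lmod] [Field Ltpd] [NumberField Ltpd] [Field L'] [NumberField L']
    [Algebra Lmod Ltpd] [IsGalois Lmod Ltpd] [Algebra Ltpd L']
    (hc : ∀ v : T.Pmod, (T.char v).Prime)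
    (hW : ∀ w ∈ T.Ramified, ∃ u : HeightOneSpectrum (𝓞 L'), residueChar L' u = T.charW w ∧ 2 ≤ u.asIdeal.ramificationIdx ℤ)
    (S : Finset (HeightOneSpectrum (𝓞 Lmod))) (S₀ : Finset (HeightOneSpectrum (𝓞 Ltpd)))
    (hS₀ : ∀ w₀, w₀ ∈ S₀ ↔ finBelow Lmod Ltpd w₀ ∈ S)
    (hdmod : d.dmod = Module.finrank ℚ Lmod)
    (hdiff : d.logDiffTpd = ndeg Ltpd (differentDivisor Ltpd))
    (hcond : d.logCondTpd = ndeg Ltpd (ADivisor.reduced S₀))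
    (hD0 : ∀ u : HeightOneSpectrum (𝓞 L'), 2 ≤ u.asIdeal.ramificationIdx ℤ → ¬ residueChar L' u ∣ 2 * 3 * 5 * d.l →
      finBelow Ltpd L' u ∈ S₀ ∨ 2 ≤ (finBelow Ltpd L' u).asIdeal.ramificationIdx ℤ) :
    d.Eq6811 := by
  refine d.eq6811_of_genuineTower Lmod Ltpd L' S S₀ hS₀ hdmod hdiff hcond G.logsQ_eq_sum_log (fun q hq => G.vdst_prime hc hq)
    (fun q hq => ?_) hD0
  obtain ⟨w, hw, hwq⟩ := G.exists_ramified_of_mem_vdst hq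
  obtain ⟨u, hu, hram⟩ := hW w hw
  exact Or.inr ⟨u, hu.trans hwq, hram⟩

end TowerGlue

end PrimeTowerDatum

end Summit.ABC.IUTFork.Joshi.ATS4

end
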